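import Summits.QuantumFields.QCD.Theorems.QuarksAsStableActionStableActionBridgeTwistedConnected
import Summits.QuantumFields.QCD.Theorems.QuarksAsStableActionStableActionBridgeVacuumConnectedLowerBound

/-!
# The twisted Goldstone lower bound (transfer-data form) — capstone of the cycle-5 Goldstone chain
(crux `QuarksAsStableAction.StableActionBridge`, item stmt-QuantumFields-9737, line `Sketch`; continuation lead c4;
registered sub-goal `twisted_goldstone_lower_bound`)

Since the re-type of the summit conjunct (p117723, 2026-08-16) `QCDOf N_f` conjoins `IsChiralAtZero`: for every
`ε > 0` some positive mass tuple has NO uniform lattice mass gap `ε`.  Its consumption point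
(`not_hasLatticeMassGap_of_slow_decay`, p122852) is a LOWER bound `c e^{−μ a_k n_k}`, `μ < ε`, on a connected
correlator of the statement's lattice functional — which, on a time-periodic torus of extent `L`, is the
`(−1)^F`-TWISTED trace `Tr(Γ T^{L−n} A T^n B)/Tr(Γ T^L) − (Tr(Γ A T^L)/Tr(Γ T^L))(Tr(Γ B T^L)/Tr(Γ T^L))`
(Lüscher's transfer matrix `T`, fermion parity `Γ`: a contraction fixing the vacuum and commuting with `T`).

This file assembles the finite-dimensional chain landed this cycle into the bound a light state delivers there:
for `A = B†`, a unit eigenvector `e ⊥ Ω` of `T` with eigenvalue `λ` (a one-particle state of mass `−log λ`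
in lattice units) gives

  `Re [twisted connected correlator of B†, B at separation n] ≥ λ^n |⟪e, BΩ⟫|² − 10 ‖B‖² ε_{L−n}/(1 − ε_{L−n})`

whenever the thermal smallness `ε_{L−n} := Re Tr T^{L−n} − 1` is `≤ 1/2` — from
`vacuum_connected_lower_bound` (p124302: the vacuum connected function is `≥ λ^n |⟪e, BΩ⟫|²`) and
`twisted_connected_sub_vacuum_le` (p124350: twisted and vacuum connected functions differ by at most
`10 ‖B†‖ ‖B‖ ε/(1 − ε)`), with `‖B†‖ = ‖B‖`.  What separates this from `IsChiralAtZero` proper is the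
identification of the statement's Grassmann/Wilson functional `qcdLatticeConnectedCorr` with such a twisted
trace (the gauge half of Lüscher's transfer-matrix construction, F3 of the census) and the existence of the
light state with `λ_k^{n_k} = e^{−μ a_k n_k}`, `μ → 0` as `m → 0⁺` (Goldstone) — both inside the held stub
`stub_chiralCompletion`.
-/

namespace Summit.QuantumFields.QCD.Cruxes.StableActionBridge.Sketch

open scoped InnerProductSpace ComplexOrder
open Literature.Probability.LatticeModels

/-- **Twisted Goldstone lower bound.** For transfer data `(T, Ω)` on a finite-dimensional Hilbert space, a
contraction `Γ` fixing `Ω` and commuting with `T`, a bounded `B`, and a unit eigenvector `e ⊥ Ω` of `T` with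
eigenvalue `λ`: if the thermal smallness `ε := Re Tr T^{L−n} − 1` is at most `1/2`, then the real part of the
twisted connected correlator
`Tr(Γ T^{L−n} B† T^n B)/Tr(Γ T^L) − (Tr(Γ B† T^L)/Tr(Γ T^L)) (Tr(Γ B T^L)/Tr(Γ T^L))`
is at least `λ^n |⟪e, BΩ⟫|² − 10 ‖B‖² ε/(1 − ε)`. [folklore] -/
theorem twisted_goldstone_lower_bound : ∀ (H : Type) [NormedAddCommGroup H] [InnerProductSpace ℂ H]
    [CompleteSpace H] [FiniteDimensional ℂ H] (D : TransferData H) (Γ B : H →L[ℂ] H) (e : H) (lam : ℝ),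
    ‖Γ‖ ≤ 1 → Γ D.vacuum = D.vacuum → Γ * D.T = D.T * Γ → D.T e = (lam : ℂ) • e → ‖e‖ = 1 →
    ⟪D.vacuum, e⟫_ℂ = 0 → ∀ L n : ℕ, n ≤ L →
    (LinearMap.trace ℂ H ((D.T ^ (L - n) : H →L[ℂ] H) : H →ₗ[ℂ] H)).re - 1 ≤ 1 / 2 →
    lam ^ n * ‖⟪e, B D.vacuum⟫_ℂ‖ ^ 2 -
        10 * ‖B‖ ^ 2 * ((LinearMap.trace ℂ H ((D.T ^ (L - n) : H →L[ℂ] H) : H →ₗ[ℂ] H)).re - 1) /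
          (1 - ((LinearMap.trace ℂ H ((D.T ^ (L - n) : H →L[ℂ] H) : H →ₗ[ℂ] H)).re - 1)) ≤
      (LinearMap.trace ℂ H
            ((Γ * D.T ^ (L - n) * ContinuousLinearMap.adjoint B * D.T ^ n * B : H →L[ℂ] H) : H →ₗ[ℂ] H) /
          LinearMap.trace ℂ H ((Γ * D.T ^ L : H →L[ℂ] H) : H →ₗ[ℂ] H) -
        (LinearMap.trace ℂ H ((Γ * ContinuousLinearMap.adjoint B * D.T ^ L : H →L[ℂ] H) : H →ₗ[ℂ] H) /
            LinearMap.trace ℂ H ((Γ * D.T ^ L : H →L[ℂ] H) : H →ₗ[ℂ] H)) *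
          (LinearMap.trace ℂ H ((Γ * B * D.T ^ L : H →L[ℂ] H) : H →ₗ[ℂ] H) /
            LinearMap.trace ℂ H ((Γ * D.T ^ L : H →L[ℂ] H) : H →ₗ[ℂ] H))).re := by
  intro H _ _ _ _ D Γ B e lam hΓ hΓΩ hcomm he he1 hΩe L n hn hε
  -- the two landed ingredients
  have hvac := vacuum_connected_lower_bound H D B e lam n he he1 hΩe
  have htw := twisted_connected_sub_vacuum_le H D Γ (ContinuousLinearMap.adjoint B) B hΓ hΓΩ hcomm L n hn hε
  rw [LinearIsometryEquiv.norm_map] at htw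
  -- abbreviations
  set X : ℂ := LinearMap.trace ℂ H
      ((Γ * D.T ^ (L - n) * ContinuousLinearMap.adjoint B * D.T ^ n * B : H →L[ℂ] H) : H →ₗ[ℂ] H) /
        LinearMap.trace ℂ H ((Γ * D.T ^ L : H →L[ℂ] H) : H →ₗ[ℂ] H) -
      (LinearMap.trace ℂ H ((Γ * ContinuousLinearMap.adjoint B * D.T ^ L : H →L[ℂ] H) : H →ₗ[ℂ] H) /
          LinearMap.trace ℂ H ((Γ * D.T ^ L : H →L[ℂ] H) : H →ₗ[ℂ] H)) *
        (LinearMap.trace ℂ H ((Γ * B * D.T ^ L : H →L[ℂ] H) : H →ₗ[ℂ] H) /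
          LinearMap.trace ℂ H ((Γ * D.T ^ L : H →L[ℂ] H) : H →ₗ[ℂ] H)) with hX
  set Y : ℂ := ⟪D.vacuum, (ContinuousLinearMap.adjoint B * D.T ^ n * B) D.vacuum⟫_ℂ -
      ⟪D.vacuum, (ContinuousLinearMap.adjoint B) D.vacuum⟫_ℂ * ⟪D.vacuum, B D.vacuum⟫_ℂ with hY
  set r : ℝ := ((LinearMap.trace ℂ H ((D.T ^ (L - n) : H →L[ℂ] H) : H →ₗ[ℂ] H)).re - 1) /
      (1 - ((LinearMap.trace ℂ H ((D.T ^ (L - n) : H →L[ℂ] H) : H →ₗ[ℂ] H)).re - 1)) with hr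
  have htw' : ‖X - Y‖ ≤ 10 * (‖B‖ * ‖B‖) * r := by
    rw [hr, ← mul_div_assoc]; exact htw
  -- Re X ≥ Re Y − ‖X − Y‖
  have hre : Y.re - ‖X - Y‖ ≤ X.re := by
    have h1 : (Y - X).re ≤ ‖Y - X‖ := Complex.re_le_norm _
    rw [Complex.sub_re, norm_sub_rev] at h1
    linarith
  have hfin : lam ^ n * ‖⟪e, B D.vacuum⟫_ℂ‖ ^ 2 - 10 * ‖B‖ ^ 2 * r ≤ X.re := by
    have : 10 * ‖B‖ ^ 2 * r = 10 * (‖B‖ * ‖B‖) * r := by ring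
    linarith
  simpa [hr, mul_div_assoc] using hfin

end Summit.QuantumFields.QCD.Cruxes.StableActionBridge.Sketch
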